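import Summits.BirchSwinnertonDyer.BirchSwinnertonDyer.Theorems.BiquadraticEisensteinDescentHeegnerTwistCouplingInSupplyQuarticMinusTripleCubeDescent
import Summits.BirchSwinnertonDyer.BirchSwinnertonDyer.Theorems.BiquadraticEisensteinDescentHeegnerTwistCouplingInSupplyQuarticMinusTripleCorner
import HarnessLib

set_option linter.dupNamespace false -- `Summit.BirchSwinnertonDyer.BirchSwinnertonDyer.Theorems.…` (summit = sub)
set_option autoImplicit false

/-!
# Crux `HeegnerTwistCouplingInSupply` (stmt-BirchSwinnertonDyer-21381) — the QUARTIC `j = 1728` corner, CUBE member `W_{p³}⁻ : y² = x³ − p³·x`: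
# ★★ the generic triple rung `cruxOnQuarticMinusCubeCornerTriple_of_BT`, modulo Burungale–Tian ONLY

Route `BiquadraticEisensteinDescent` (cell `pub/bsd-wall`, width seat `bsd-wall-cm-bed-w4` g14; `--supports` 21381, helper). Assembly of
`…QuarticMinusTripleCubeDescent` (both Selmer sets of `W_{p³}⁻^{(−sqℓ)} : y² = x³ − s²q²ℓ²p³·x` have two elements) exactly as in
`…QuarticMinusTripleCorner` for `W_p⁻`: §1 the family `W_{p³}⁻ : y² = x³ − p³x` (`Δ = 64p⁹`; twisting literal; good reduction away from `2p`
via the `ℤ`-model, hence prime support `{2, p}` of `N` WITHOUT modularity); §2 `rank = 0 ∧ Ш[2] = 0 ∧ corank_{ℤ₂} Sel_{2^∞} = 0` for the twist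
(UNCONDITIONAL), `L(1) ≠ 0` modulo Burungale–Tian ONLY (`j = 1728` ⇒ CM; continuation = tree theorem `QuarticTwist.hasEntireLFunction`,
`−s²q²ℓ²p³` fourth-power-free); §3 ★★ `cruxOnQuarticMinusCubeCornerTriple_of_BT`: for every prime `p ≡ 7 (mod 8)` and all primes `s ≡ 1`,
`q ≡ 3`, `ℓ ≡ 5 (mod 8)` with `(s/p) = (q/p) = (ℓ/p) = −1` and `h(−sqℓ) < p`, the CONCLUSION of crux 21381 for `W = W_{p³}⁻` (witness field
`ℚ(√−sqℓ)` = `…QuarticMinusTripleCorner.exists_witnessField_triple`, the SAME data as for `W_p⁻`). The rows of `…QuarticMinusTripleRows` therefore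
serve the cube member verbatim (`…QuarticMinusTripleCubeBelow`).

HONEST FRAMING: a typed sub-corner on ONE more CM curve per prime (measure zero in «all CM `W`»); the crux (residual C⁺) is untouched; BSD is not
proved by any of this. THEOREMS ONLY (no definition, no new named fact, no `sorry`). Supports stmt-BirchSwinnertonDyer-21381.
-/

noncomputable section

open scoped Classical NumberField

namespace Summit.BirchSwinnertonDyer.BirchSwinnertonDyer.Theorems.BiquadraticEisensteinDescentHeegnerTwistCouplingInSupplyQuarticMinusTripleCubeCorner

open _root_.WeierstrassCurve Literature.NumberTheory.EllipticCurves Literature.NumberTheory.EllipticCurves.XCubeAddPX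
open Literature.NumberTheory.QuadraticFields Literature.NumberTheory.QuadraticFields.Quadratic
open IsDedekindDomain Rat.HeightOneSpectrum
open Summit.BirchSwinnertonDyer.BirchSwinnertonDyer.Theorems.BiquadraticEisensteinDescentHeegnerTwistCouplingInSupplyQuarticTwistLocal
open Summit.BirchSwinnertonDyer.BirchSwinnertonDyer.Theorems.BiquadraticEisensteinDescentHeegnerTwistCouplingInSupplyQuarticTwistCorner
  (j_and_hasCM_lit lit_eq)
open Summit.BirchSwinnertonDyer.BirchSwinnertonDyer.Theorems.BiquadraticEisensteinDescentHeegnerTwistCouplingInSupplyQuarticPlusCorner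
  (not_isSquare_of_jacobiSym_eq_neg_one)
open Summit.BirchSwinnertonDyer.BirchSwinnertonDyer.Theorems.BiquadraticEisensteinDescentHeegnerTwistCouplingInSupplyQuarticMinusTripleCubeDescent
  (mem_selmer_neg_iff_triple_cube mem_selmer_pos_iff_triple_cube)
open Summit.BirchSwinnertonDyer.BirchSwinnertonDyer.Theorems.BiquadraticEisensteinDescentHeegnerTwistCouplingInSupplyQuarticMinusTripleCorner
  (jacobiSym_neg_triple_eq_one not_isSquare_mod_of_jacobiSym_eq_neg_one exists_witnessField_triple)

/-! ## §1 The family `W_{p³}⁻ : y² = x³ − p³·x` -/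

section Family

/-- **Twisting**: `(y² = x³ − p³x)^{(d)} = (y² = x³ − d²p³·x)`, in the literal of the descent files. [cite: SilvermanAEC2009, X.2 and X.5] -/
theorem quadraticTwist_Wcube (p : ℕ) (d : ℤ) :
    (⟨0, 0, 0, -(p : ℚ) ^ 3, 0⟩ : WeierstrassCurve ℚ).quadraticTwist (d : ℚ) =
      ⟨0, ((0 : ℤ) : ℚ), 0, ((-(d ^ 2 * p ^ 3) : ℤ) : ℚ), 0⟩ := by
  rw [quadraticTwist_mk]; ext <;> push_cast <;> ring

/-- The `ℤ`-model `⟨0, 0, 0, −p³, 0⟩` maps to `W_{p³}⁻`. [folklore] -/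
theorem map_WcubeInt (p : ℕ) :
    (⟨0, 0, 0, -(p : ℤ) ^ 3, 0⟩ : WeierstrassCurve ℤ).map (Int.castRingHom ℚ) = ⟨0, 0, 0, -(p : ℚ) ^ 3, 0⟩ := by
  ext <;> simp [WeierstrassCurve.map]

/-- `Δ(⟨0, 0, 0, −p³, 0⟩) = 64p⁹`. [cite: SilvermanAEC2009, III.1 (b₂, b₄, b₆, b₈, Δ)] -/
theorem WcubeInt_Δ (p : ℕ) : (⟨0, 0, 0, -(p : ℤ) ^ 3, 0⟩ : WeierstrassCurve ℤ).Δ = 64 * (p : ℤ) ^ 9 := by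
  simp only [WeierstrassCurve.Δ, WeierstrassCurve.b₂, WeierstrassCurve.b₄, WeierstrassCurve.b₆, WeierstrassCurve.b₈]
  ring

/-- A prime `r ∤ 2p` does not divide `Δ = 64p⁹`. [folklore] -/
theorem not_dvd_WcubeInt_Δ {p r : ℕ} (hr : r.Prime) (hrp : ¬ r ∣ 2 * p) :
    ¬ (r : ℤ) ∣ (⟨0, 0, 0, -(p : ℤ) ^ 3, 0⟩ : WeierstrassCurve ℤ).Δ := by
  rw [WcubeInt_Δ]
  intro h
  have h'' : r ∣ 64 * p ^ 9 := by exact_mod_cast h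
  rcases (Nat.Prime.dvd_mul hr).mp h'' with h64 | hp9
  · exact hrp ((hr.dvd_of_dvd_pow (show r ∣ 2 ^ 6 by simpa using h64)).mul_right p)
  · exact hrp ((hr.dvd_of_dvd_pow hp9).mul_left 2)

/-- **`W_{p³}⁻` has good reduction at every prime `r ∤ 2p`.** [cite: SilvermanAEC2009, VII.5 Prop. 5.1(a)] -/
theorem hasGoodReductionAtPrime_Wcube {p r : ℕ} [Fact r.Prime] (hrp : ¬ r ∣ 2 * p) :
    (⟨0, 0, 0, -(p : ℚ) ^ 3, 0⟩ : WeierstrassCurve ℚ).HasGoodReductionAtPrime r := by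
  obtain ⟨v, rfl⟩ : ∃ v : HeightOneSpectrum (𝓞 ℚ), (primesEquiv v : ℕ) = r :=
    ⟨primesEquiv.symm ⟨r, Fact.out⟩, by rw [Equiv.apply_symm_apply]⟩
  rw [← map_WcubeInt]
  exact (hasGoodReductionAtPrime_iff_hasGoodReductionAt_ringOfIntegers v _).2
    (hasGoodReductionAt_map_of_not_dvd _ v (not_dvd_WcubeInt_Δ Fact.out hrp))

/-- **Every prime divisor of `N(W_{p³}⁻)` is `2` or `p`** (no modularity). [cite: SilvermanATAEC1994, Thm. IV.10.2(a)] -/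
theorem eq_two_or_eq_of_prime_dvd_conductorNorm_Wcube {p r : ℕ} [(⟨0, 0, 0, -(p : ℚ) ^ 3, 0⟩ : WeierstrassCurve ℚ).IsElliptic]
    (hp : p.Prime) (hr : r.Prime) (h : r ∣ (⟨0, 0, 0, -(p : ℚ) ^ 3, 0⟩ : WeierstrassCurve ℚ).conductorNorm ℤ) : r = 2 ∨ r = p := by
  by_contra hne
  push Not at hne
  have hrp : ¬ r ∣ 2 * p := fun hd => by
    rcases (Nat.Prime.dvd_mul hr).mp hd with h2 | hp'
    · exact hne.1 ((Nat.prime_dvd_prime_iff_eq hr Nat.prime_two).mp h2)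
    · exact hne.2 ((Nat.prime_dvd_prime_iff_eq hr hp).mp hp')
  haveI : Fact r.Prime := ⟨hr⟩
  exact not_dvd_conductorNorm_of_hasGoodReductionAtPrime _ (hasGoodReductionAtPrime_Wcube hrp) h

end Family

/-! ## §2 The twist `E = W_{p³}⁻^{(−sqℓ)} : y² = x³ − s²q²ℓ²p³·x` -/

section Twist

variable {p q s l : ℕ} [hp : Fact p.Prime] [hq : Fact q.Prime] [hs : Fact s.Prime] [hl : Fact l.Prime]

/-- **Both Selmer sets have two elements** for the cube member's twist, so `dim₂ S = dim₂ S′ = 1`. [cite: SilvermanAEC2009, Prop. X.4.9 and Prop. X.6.1] -/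
theorem twoIsogenySelmerRank_triple_cube (hp8 : p % 8 = 7) (hs8 : s % 8 = 1) (hq8 : q % 8 = 3) (hl8 : l % 8 = 5)
    (hnq : ¬ IsSquare ((q : ℤ) : ZMod p)) (hps : ¬ IsSquare ((p : ℤ) : ZMod s)) (hpl : ¬ IsSquare ((p : ℤ) : ZMod l)) :
    twoIsogenySelmerRank 0 (-(s ^ 2 * q ^ 2 * l ^ 2 * p ^ 3 : ℤ)) = 1 ∧
      twoIsogenySelmerRank' 0 (-(s ^ 2 * q ^ 2 * l ^ 2 * p ^ 3 : ℤ)) = 1 := by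
  have hP := hp.out
  have h1p : (1 : ℤ) ≠ -(p : ℤ) := by have := hP.one_lt; omega
  have h1p' : (1 : ℤ) ≠ (p : ℤ) := by exact_mod_cast hP.one_lt.ne
  have hS : twoIsogenySelmerGroup 0 (-(s ^ 2 * q ^ 2 * l ^ 2 * p ^ 3 : ℤ)) = {1, -(p : ℤ)} := by
    ext d
    rw [mem_selmer_neg_iff_triple_cube hp8 hs8 hq8 hl8 hnq hps hpl, Finset.mem_insert, Finset.mem_singleton]
  have hS' : twoIsogenySelmerGroup' 0 (-(s ^ 2 * q ^ 2 * l ^ 2 * p ^ 3 : ℤ)) = {1, (p : ℤ)} := by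
    rw [twoIsogenySelmerGroup'_eq, show (-2 * 0 : ℤ) = 0 by norm_num,
      show ((0 : ℤ) ^ 2 - 4 * (-(s ^ 2 * q ^ 2 * l ^ 2 * p ^ 3 : ℤ))) = 4 * s ^ 2 * q ^ 2 * l ^ 2 * p ^ 3 by ring]
    ext d
    rw [mem_selmer_pos_iff_triple_cube hp8 hs8 hq8 hl8 hnq hps hpl, Finset.mem_insert, Finset.mem_singleton]
  refine ⟨?_, ?_⟩
  · rw [twoIsogenySelmerRank, hS, Finset.card_pair h1p]
    exact Nat.log_pow Nat.one_lt_two 1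
  · rw [twoIsogenySelmerRank'_eq, hS', Finset.card_pair h1p']
    exact Nat.log_pow Nat.one_lt_two 1

/-- ★ **`rank = 0`, `Ш[2] = 0`, `corank_{ℤ₂} Sel_{2^∞} = 0` for `E : y² = x³ − s²q²ℓ²p³·x`** in the triple cell — UNCONDITIONAL.
[cite: SilvermanAEC2009, Prop. X.4.7 and Thm. X.4.2(a); Prop. X.6.1] [cite: Greenberg1999LNM, §1 pp. 54–57] -/
theorem rank_sha_corank_triple_cube (hp8 : p % 8 = 7) (hs8 : s % 8 = 1) (hq8 : q % 8 = 3) (hl8 : l % 8 = 5)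
    (hnq : ¬ IsSquare ((q : ℤ) : ZMod p)) (hps : ¬ IsSquare ((p : ℤ) : ZMod s)) (hpl : ¬ IsSquare ((p : ℤ) : ZMod l))
    [hE : (⟨0, ((0 : ℤ) : ℚ), 0, ((-(s ^ 2 * q ^ 2 * l ^ 2 * p ^ 3) : ℤ) : ℚ), 0⟩ : WeierstrassCurve ℚ).IsElliptic] :
    (⟨0, ((0 : ℤ) : ℚ), 0, ((-(s ^ 2 * q ^ 2 * l ^ 2 * p ^ 3) : ℤ) : ℚ), 0⟩ : WeierstrassCurve ℚ).mordellWeilRank = 0 ∧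
    (∀ c ∈ (⟨0, ((0 : ℤ) : ℚ), 0, ((-(s ^ 2 * q ^ 2 * l ^ 2 * p ^ 3) : ℤ) : ℚ), 0⟩ : WeierstrassCurve ℚ).sha, 2 • c = 0 → c = 0) ∧
    (⟨0, ((0 : ℤ) : ℚ), 0, ((-(s ^ 2 * q ^ 2 * l ^ 2 * p ^ 3) : ℤ) : ℚ), 0⟩ : WeierstrassCurve ℚ).selmerCorank 2 = 0 := by
  have hP := hp.out
  have hp0 : (p : ℤ) ≠ 0 := by exact_mod_cast hP.ne_zero
  have hq0 : (q : ℤ) ≠ 0 := by exact_mod_cast hq.out.ne_zero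
  have hs0 : (s : ℤ) ≠ 0 := by exact_mod_cast hs.out.ne_zero
  have hl0 : (l : ℤ) ≠ 0 := by exact_mod_cast hl.out.ne_zero
  have hb : (-(s ^ 2 * q ^ 2 * l ^ 2 * p ^ 3 : ℤ)) ≠ 0 :=
    neg_ne_zero.mpr (mul_ne_zero (mul_ne_zero (mul_ne_zero (pow_ne_zero 2 hs0) (pow_ne_zero 2 hq0)) (pow_ne_zero 2 hl0)) (pow_ne_zero 3 hp0))
  have hab : (-(s ^ 2 * q ^ 2 * l ^ 2 * p ^ 3 : ℤ)) * ((0 : ℤ) ^ 2 - 4 * (-(s ^ 2 * q ^ 2 * l ^ 2 * p ^ 3 : ℤ))) ≠ 0 := by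
    refine mul_ne_zero hb ?_
    rw [show ((0 : ℤ) ^ 2 - 4 * (-(s ^ 2 * q ^ 2 * l ^ 2 * p ^ 3 : ℤ))) = 4 * (s ^ 2 * q ^ 2 * l ^ 2 * p ^ 3) by ring]
    exact mul_ne_zero (by norm_num) (neg_ne_zero.mp hb)
  haveI := isElliptic_halfModel hab
  obtain ⟨h1, h2⟩ := twoIsogenySelmerRank_triple_cube hp8 hs8 hq8 hl8 hnq hps hpl
  have hle : twoIsogenySelmerRank 0 (-(s ^ 2 * q ^ 2 * l ^ 2 * p ^ 3 : ℤ)) + twoIsogenySelmerRank' 0 (-(s ^ 2 * q ^ 2 * l ^ 2 * p ^ 3 : ℤ)) ≤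
      (⟨0, ((0 : ℤ) : ℚ), 0, ((-(s ^ 2 * q ^ 2 * l ^ 2 * p ^ 3) : ℤ) : ℚ), 0⟩ : WeierstrassCurve ℚ).mordellWeilRank + 2 := by
    rw [h1, h2]; omega
  obtain ⟨-, -, hsum⟩ := natCard_sha_inf_range_eq_one_of_selmerRank_add_le hab hle
  have hrank : (⟨0, ((0 : ℤ) : ℚ), 0, ((-(s ^ 2 * q ^ 2 * l ^ 2 * p ^ 3) : ℤ) : ℚ), 0⟩ : WeierstrassCurve ℚ).mordellWeilRank = 0 := by
    rw [h1, h2] at hsum; omega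
  have hsha := forall_mem_sha_two_smul_eq_zero_of_selmerRank_add_le hab hle
  haveI : Fact (Nat.Prime 2) := ⟨Nat.prime_two⟩
  refine ⟨hrank, hsha, ?_⟩
  rw [(⟨0, ((0 : ℤ) : ℚ), 0, ((-(s ^ 2 * q ^ 2 * l ^ 2 * p ^ 3) : ℤ) : ℚ), 0⟩ : WeierstrassCurve ℚ).selmerCorank_eq_mordellWeilRank_add_holds 2,
    hrank, (⟨0, ((0 : ℤ) : ℚ), 0, ((-(s ^ 2 * q ^ 2 * l ^ 2 * p ^ 3) : ℤ) : ℚ), 0⟩ : WeierstrassCurve ℚ).shaCorank_eq_zero_of_forall 2 hsha]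

omit hp hq hs hl in
/-- `b = −s²q²ℓ²p³` (`s, q, ℓ, p` distinct primes) is free of fourth powers. [folklore] -/
theorem not_pow_four_dvd_triple_cube (hP : p.Prime) (hQ : q.Prime) (hS : s.Prime) (hL : l.Prime) (hsp : s ≠ p) (hqp : q ≠ p)
    (hlp : l ≠ p) (hsq : s ≠ q) (hsl : s ≠ l) (hql : q ≠ l) (r : ℕ) (hr : r.Prime) :
    ¬ (r : ℤ) ^ 4 ∣ -(s ^ 2 * q ^ 2 * l ^ 2 * p ^ 3 : ℤ) := by
  intro h
  have h' : r ^ 4 ∣ s ^ 2 * q ^ 2 * l ^ 2 * p ^ 3 := by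
    have := Int.natAbs_dvd_natAbs.mpr h
    simpa [Int.natAbs_mul, Int.natAbs_pow, Int.natAbs_neg] using this
  have hcop : ∀ {a b : ℕ} (m n : ℕ), a.Prime → b.Prime → a ≠ b → Nat.Coprime (a ^ m) (b ^ n) := fun m n ha hb hab =>
    Nat.Coprime.pow m n ((Nat.coprime_primes ha hb).mpr hab)
  by_cases hrs : r = s
  · subst hrs
    have h1 : r ^ 4 ∣ r ^ 2 := by
      rw [show r ^ 2 * q ^ 2 * l ^ 2 * p ^ 3 = r ^ 2 * (q ^ 2 * l ^ 2 * p ^ 3) by ring] at h'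
      exact (((hcop 4 2 hS hQ hsq).mul_right (hcop 4 2 hS hL hsl)).mul_right (hcop 4 3 hS hP hsp)).dvd_of_dvd_mul_right h'
    have := (Nat.pow_dvd_pow_iff_le_right hS.one_lt).mp h1
    omega
  by_cases hrq : r = q
  · subst hrq
    have h1 : r ^ 4 ∣ r ^ 2 := by
      rw [show s ^ 2 * r ^ 2 * l ^ 2 * p ^ 3 = r ^ 2 * (s ^ 2 * l ^ 2 * p ^ 3) by ring] at h'
      exact (((hcop 4 2 hQ hS (Ne.symm hsq)).mul_right (hcop 4 2 hQ hL hql)).mul_right (hcop 4 3 hQ hP hqp)).dvd_of_dvd_mul_right h'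
    have := (Nat.pow_dvd_pow_iff_le_right hQ.one_lt).mp h1
    omega
  by_cases hrl : r = l
  · subst hrl
    have h1 : r ^ 4 ∣ r ^ 2 := by
      rw [show s ^ 2 * q ^ 2 * r ^ 2 * p ^ 3 = r ^ 2 * (s ^ 2 * q ^ 2 * p ^ 3) by ring] at h'
      exact (((hcop 4 2 hL hS (Ne.symm hsl)).mul_right (hcop 4 2 hL hQ (Ne.symm hql))).mul_right (hcop 4 3 hL hP hlp)).dvd_of_dvd_mul_right h'
    have := (Nat.pow_dvd_pow_iff_le_right hL.one_lt).mp h1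
    omega
  by_cases hrp : r = p
  · subst hrp
    have h1 : r ^ 4 ∣ r ^ 3 := by
      rw [show s ^ 2 * q ^ 2 * l ^ 2 * r ^ 3 = r ^ 3 * (s ^ 2 * q ^ 2 * l ^ 2) by ring] at h'
      exact (((hcop 4 2 hP hS (Ne.symm hsp)).mul_right (hcop 4 2 hP hQ (Ne.symm hqp))).mul_right
        (hcop 4 2 hP hL (Ne.symm hlp))).dvd_of_dvd_mul_right h'
    have := (Nat.pow_dvd_pow_iff_le_right hP.one_lt).mp h1
    omega
  · have hc : Nat.Coprime (r ^ 4) (s ^ 2 * q ^ 2 * l ^ 2 * p ^ 3) :=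
      ((((hcop 4 2 hr hS hrs).mul_right (hcop 4 2 hr hQ hrq)).mul_right (hcop 4 2 hr hL hrl)).mul_right (hcop 4 3 hr hP hrp))
    have h1 : r ^ 4 ∣ 1 := hc.dvd_of_dvd_mul_right (by simpa using h')
    have := Nat.le_of_dvd one_pos h1
    have := Nat.one_lt_pow (n := 4) (by norm_num) hr.one_lt
    omega

/-- ★ **`L`-form, ONE named fact**: `r_an(E) = 0` and `L(E, 1) ≠ 0` for `E : y² = x³ − s²q²ℓ²p³·x` in the triple cell, modulo
Burungale–Tian ONLY (continuation = `QuarticTwist.hasEntireLFunction`). [cite: BurungaleTian2026, Thm. 1.1] [cite: IrelandRosen1990, Ch. 18 §6 Theorem 7] -/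
theorem L_one_ne_zero_triple_cube_of_BT (hBT : burungaleTian_analyticRank_eq_zero_of_selmerCorank_eq_zero_of_hasCM)
    (hp8 : p % 8 = 7) (hs8 : s % 8 = 1) (hq8 : q % 8 = 3) (hl8 : l % 8 = 5)
    (hnq : ¬ IsSquare ((q : ℤ) : ZMod p)) (hps : ¬ IsSquare ((p : ℤ) : ZMod s)) (hpl : ¬ IsSquare ((p : ℤ) : ZMod l))
    [hE : (⟨0, ((0 : ℤ) : ℚ), 0, ((-(s ^ 2 * q ^ 2 * l ^ 2 * p ^ 3) : ℤ) : ℚ), 0⟩ : WeierstrassCurve ℚ).IsElliptic] :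
    (⟨0, ((0 : ℤ) : ℚ), 0, ((-(s ^ 2 * q ^ 2 * l ^ 2 * p ^ 3) : ℤ) : ℚ), 0⟩ : WeierstrassCurve ℚ).analyticRank = 0 ∧
    (⟨0, ((0 : ℤ) : ℚ), 0, ((-(s ^ 2 * q ^ 2 * l ^ 2 * p ^ 3) : ℤ) : ℚ), 0⟩ : WeierstrassCurve ℚ).entireLFunction 1 ≠ 0 := by
  haveI : Fact (Nat.Prime 2) := ⟨Nat.prime_two⟩
  have hP := hp.out
  have hQ := hq.out
  have hS := hs.out
  have hL := hl.out
  have hb : (-(s ^ 2 * q ^ 2 * l ^ 2 * p ^ 3 : ℤ)) ≠ 0 :=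
    neg_ne_zero.mpr (mul_ne_zero (mul_ne_zero (mul_ne_zero (pow_ne_zero 2 (by exact_mod_cast hS.ne_zero))
      (pow_ne_zero 2 (by exact_mod_cast hQ.ne_zero))) (pow_ne_zero 2 (by exact_mod_cast hL.ne_zero)))
      (pow_ne_zero 3 (by exact_mod_cast hP.ne_zero)))
  obtain ⟨-, hCM⟩ := j_and_hasCM_lit hb
  obtain ⟨-, -, hcor⟩ := rank_sha_corank_triple_cube hp8 hs8 hq8 hl8 hnq hps hpl
  have h0 := hBT _ hCM 2 hcor
  have h4 := not_pow_four_dvd_triple_cube hP hQ hS hL (by rintro rfl; omega) (by rintro rfl; omega) (by rintro rfl; omega)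
    (by rintro rfl; omega) (by rintro rfl; omega) (by rintro rfl; omega)
  have hH := QuarticTwist.hasEntireLFunction hb h4
  rw [← lit_eq] at hH
  exact ⟨h0, (analyticRank_eq_zero_iff_holds
    (W := (⟨0, ((0 : ℤ) : ℚ), 0, ((-(s ^ 2 * q ^ 2 * l ^ 2 * p ^ 3) : ℤ) : ℚ), 0⟩ : WeierstrassCurve ℚ)) hH).1 h0⟩

end Twist

/-! ## §3 ★★ The generic triple rung for `W = W_{p³}⁻`, modulo Burungale–Tian only -/

section Corner

/-- The common final step: from the triple data `(s, q, ℓ)` to the `L`-value of the cube member's twist by `−sqℓ`. [folklore] -/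
theorem L_twist_ne_zero_triple_cube (hBT : burungaleTian_analyticRank_eq_zero_of_selmerCorank_eq_zero_of_hasCM) {p s q l : ℕ}
    (hp : p.Prime) (hs : s.Prime) (hq : q.Prime) (hl : l.Prime) (hp8 : p % 8 = 7) (hs8 : s % 8 = 1) (hq8 : q % 8 = 3)
    (hl8 : l % 8 = 5) (hJs : jacobiSym (s : ℤ) p = -1) (hJq : jacobiSym (q : ℤ) p = -1) (hJl : jacobiSym (l : ℤ) p = -1) :
    ((⟨0, 0, 0, -(p : ℚ) ^ 3, 0⟩ : WeierstrassCurve ℚ).quadraticTwist ((-((s * q * l : ℕ) : ℤ) : ℤ) : ℚ)).entireLFunction 1 ≠ 0 := by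
  haveI := Fact.mk hp; haveI := Fact.mk hs; haveI := Fact.mk hq; haveI := Fact.mk hl
  have hnq : ¬ IsSquare ((q : ℤ) : ZMod p) := not_isSquare_of_jacobiSym_eq_neg_one hJq
  have hps : ¬ IsSquare ((p : ℤ) : ZMod s) := not_isSquare_mod_of_jacobiSym_eq_neg_one (by omega) (by omega) hJs
  have hpl : ¬ IsSquare ((p : ℤ) : ZMod l) := not_isSquare_mod_of_jacobiSym_eq_neg_one (by omega) (by omega) hJl
  rw [quadraticTwist_Wcube]
  rw [show (-((-((s * q * l : ℕ) : ℤ)) ^ 2 * p ^ 3) : ℤ) = (-(s ^ 2 * q ^ 2 * l ^ 2 * p ^ 3) : ℤ) by push_cast; ring]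
  have hb : (-(s ^ 2 * q ^ 2 * l ^ 2 * p ^ 3 : ℤ)) ≠ 0 :=
    neg_ne_zero.mpr (mul_ne_zero (mul_ne_zero (mul_ne_zero (pow_ne_zero 2 (by exact_mod_cast hs.ne_zero))
      (pow_ne_zero 2 (by exact_mod_cast hq.ne_zero))) (pow_ne_zero 2 (by exact_mod_cast hl.ne_zero)))
      (pow_ne_zero 3 (by exact_mod_cast hp.ne_zero)))
  have hab : (-(s ^ 2 * q ^ 2 * l ^ 2 * p ^ 3 : ℤ)) * ((0 : ℤ) ^ 2 - 4 * (-(s ^ 2 * q ^ 2 * l ^ 2 * p ^ 3 : ℤ))) ≠ 0 := by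
    refine mul_ne_zero hb ?_
    rw [show ((0 : ℤ) ^ 2 - 4 * (-(s ^ 2 * q ^ 2 * l ^ 2 * p ^ 3 : ℤ))) = 4 * (s ^ 2 * q ^ 2 * l ^ 2 * p ^ 3) by ring]
    exact mul_ne_zero (by norm_num) (neg_ne_zero.mp hb)
  haveI := isElliptic_mk_of_ne_zero (F := ℚ) hab
  exact (L_one_ne_zero_triple_cube_of_BT hBT hp8 hs8 hq8 hl8 hnq hps hpl).2

/-- ★★ **THE TRIPLE RUNG FOR THE CUBE MEMBER `W = W_{p³}⁻`, ONE NAMED FACT.** For every prime `p ≡ 7 (mod 8)` and all primes `s ≡ 1`, `q ≡ 3`,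
`ℓ ≡ 5 (mod 8)` with `(s/p) = (q/p) = (ℓ/p) = −1` and `h(K) < p` for every imaginary quadratic `K` of discriminant `−sqℓ`: there is a Heegner field
`K′ = ℚ(√−sqℓ)` of `N(W_{p³}⁻)` (prime support `{2, p}`) with `4 < |d_{K′}|`, `L(W_{p³}⁻^{(d_{K′})}, 1) ≠ 0` (sharp `2`-isogeny descent of
`y² = x³ − s²q²ℓ²p³·x` — UNCONDITIONAL, Legendre-only — then Burungale–Tian at `2` and the PROVED continuation), `h(K′) < p`, `p ∤ h(K′)` — the
CONCLUSION of crux 21381 for `W = W_{p³}⁻`, modulo Burungale–Tian ONLY. [cite: BurungaleTian2026, Thm. 1.1]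
[cite: SilvermanAEC2009, Prop. X.4.9, Prop. X.4.7, Thm. X.4.2(a)] [cite: IrelandRosen1990, Ch. 18 §6 Theorem 7] -/
theorem cruxOnQuarticMinusCubeCornerTriple_of_BT (hBT : burungaleTian_analyticRank_eq_zero_of_selmerCorank_eq_zero_of_hasCM) :
    ∀ (p : ℕ) [Fact p.Prime] [(⟨0, 0, 0, -(p : ℚ) ^ 3, 0⟩ : WeierstrassCurve ℚ).IsElliptic]
      [(⟨0, 0, 0, -(p : ℚ) ^ 3, 0⟩ : WeierstrassCurve ℚ).IsGloballyMinimal]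
      [NeZero ((⟨0, 0, 0, -(p : ℚ) ^ 3, 0⟩ : WeierstrassCurve ℚ).conductorNorm ℤ)],
      p % 8 = 7 → ∀ s q l : ℕ, s.Prime → q.Prime → l.Prime → s % 8 = 1 → q % 8 = 3 → l % 8 = 5 →
      jacobiSym (s : ℤ) p = -1 → jacobiSym (q : ℤ) p = -1 → jacobiSym (l : ℤ) p = -1 →
      (∀ (K : Type) [Field K] [NumberField K], IsImaginaryQuadratic K →
        NumberField.discr K = -((s * q * l : ℕ) : ℤ) → NumberField.classNumber K < p) →
      ∃ (K : Type) (_ : Field K) (_ : NumberField K),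
        IsImaginaryQuadratic K ∧ 4 < (NumberField.discr K).natAbs ∧
        SatisfiesHeegnerHypothesis ((⟨0, 0, 0, -(p : ℚ) ^ 3, 0⟩ : WeierstrassCurve ℚ).conductorNorm ℤ) K ∧
        ((⟨0, 0, 0, -(p : ℚ) ^ 3, 0⟩ : WeierstrassCurve ℚ).quadraticTwist (NumberField.discr K : ℚ)).entireLFunction 1 ≠ 0 ∧
        NumberField.classNumber K < p ∧ ¬ p ∣ NumberField.classNumber K := by
  intro p hpF _ _ _ hp8 s q l hs hq hl hs8 hq8 hl8 hJs hJq hJl hh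
  have hp : p.Prime := hpF.out
  obtain ⟨K, iF, iN, hK, hdK, hH', hcl⟩ := exists_witnessField_triple (N := (⟨0, 0, 0, -(p : ℚ) ^ 3, 0⟩ : WeierstrassCurve ℚ).conductorNorm ℤ)
    hs hs8 hq hq8 hl hl8 (jacobiSym_neg_triple_eq_one (by omega) hJs hJq hJl) hh
    (fun r hr hrN => eq_two_or_eq_of_prime_dvd_conductorNorm_Wcube hp hr hrN)
  refine ⟨K, iF, iN, hK, ?_, hH', ?_, hcl, fun hdvd => absurd (Nat.le_of_dvd (NumberField.classNumber_pos K) hdvd) (not_le.mpr hcl)⟩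
  · rw [hdK, Int.natAbs_neg, Int.natAbs_natCast]
    have h9 : 9 ≤ s := by have := hs.two_le; omega
    have h3 : 3 ≤ q := by have := hq.two_le; omega
    have h5 : 5 ≤ l := by have := hl.two_le; omega
    calc 4 < 9 * 3 * 5 := by norm_num
      _ ≤ s * q * l := Nat.mul_le_mul (Nat.mul_le_mul h9 h3) h5
  · rw [hdK]
    exact L_twist_ne_zero_triple_cube hBT hp hs hq hl hp8 hs8 hq8 hl8 hJs hJq hJl

end Corner

end Summit.BirchSwinnertonDyer.BirchSwinnertonDyer.Theorems.BiquadraticEisensteinDescentHeegnerTwistCouplingInSupplyQuarticMinusTripleCubeCorner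

end
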